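import Mathlib.Algebra.BigOperators.Fin
import Mathlib.Algebra.Order.BigOperators.Group.Finset
import Mathlib.Data.Fin.Tuple.Basic
import Mathlib.Data.ZMod.Basic
import Mathlib.Tactic
import HarnessLib

/-!
# `AND` is not a short linear combination of product functions (Barrington–Straubing–Thérien 1990, Thm. 7)

Barrington–Straubing–Thérien, *Non-uniform automata over groups* (Inf. Comput. 89 (1990)),
§6, Theorem 7: over a finite field `F` with `|F*| = k`, "the AND function cannot be written as
an `F`-linear combination of fewer than `(k/(k−1))ⁿ` of the functions `Q_w`", where for
`w ∈ (F*)ⁿ` the PRODUCT FUNCTION `Q_w : {0,1}ⁿ → F` is `Q_w(u) = Π_i w_i^{u_i}` (p. 124). This is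
the engine of every exponential lower bound for depth-two circuits with two different moduli
(`MOD_q ∘ MOD_m`, the `d = 1` case of the Constant Degree Hypothesis, BST90 §7–8; Krause–Pudlák
1997; Grolmusz–Tardos 2000): a `MOD_m` gate of a linear form is a combination of `m` product
functions with entries in the `m`-th roots of unity, and the number of product functions is
sub-multiplicative under products.

We prove the theorem in a slightly more general form and by a shorter route than the printed
Fourier-transform argument (BST90 pp. 123–125: `supp(f)·weight(f) ≥ kⁿ`): for ANY nontrivial
commutative ring `R` and any finite set `S ⊆ R` of `k` admissible entries, if
`AND_n = Σ_{w ∈ W} c_w Q_w` on `{0,1}ⁿ` with `W ⊆ Sⁿ`, then `kⁿ ≤ |W|·(k−1)ⁿ`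
(`pow_le_card_mul_pow_of_and_eq_sum_prodFn`, stated for any `k ≥ |S|`). Proof: induction on `n`; restrict the first variable to
`1` and to `0` and subtract `λ` times the second identity from the first, where `λ ∈ S` is the most
popular first entry among `W` (pigeonhole: `≥ |W|/k` of them) — the terms with first entry `λ`
cancel and what remains represents `AND_{n−1}` with at most `|W|(k−1)/k` product functions.

* `prodFn w` (`Q_w`), `andFn R n` (`AND_n` with values `0,1 ∈ R`), `prodFn_cons_true/false`,
  `prodFn_mul` (`Q_v · Q_w = Q_{vw}`, BST90 p. 124 "Observe that `Q_v · Q_w = Q_{vw}`");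
* `pow_le_card_mul_pow_of_and_eq_sum_prodFn` — Theorem 7 (generalised), in the cross-multiplied
  form `kⁿ ≤ |W|·(k−1)ⁿ` over `ℕ` for every `k ≥ |S|`;
* the span of a FIXED finite set `𝒲` of product functions (`InSpan 𝒲 f`) and its closure under
  `+`, scalars, `Σ`, products (`pairMul`, "weight is submultiplicative", §7 p. 125) and powers
  (`powSet`, `card_powSet_le : |𝒲^{(e)}| ≤ |𝒲|^e`), and Theorem 7 in that form
  (`InSpan.pow_le_card_mul_pow`) — the counting used for `MOD`-gate circuits
  (`Literature/Barriers/QuantumAdvantage/TwoModuliDepthTwo.lean`);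
* the `MOD_r`-TARGET form (BST90 §8 / Krause–Pudlák 1997 / Grolmusz–Tardos 2000 product-function
  core): `pow_le_card_mul_pow_of_modPeriodic_eq_sum_prodFn` / `InSpan.pow_le_card_mul_pow_modPeriodic`
  — over a field `F` with `(r : F) ≠ 0` and admissible entries `S` containing no `r`-th root of
  unity except `1`, a representation of any NON-CONSTANT `r`-periodic symmetric function
  `u ↦ γ(|u| mod r)` needs `|W| ≥ (k/(k−1))^{n−r+1}` product functions (`exists_ne_shiftSub`: the
  twisted difference `γ(j+1) − λγ(j)` of a non-constant `γ` is non-constant).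

## References

* D. A. Mix Barrington, H. Straubing, D. Thérien, *Non-uniform automata over groups*, Inform.
  and Comput. 89 (1990) 109–132, §6 (Theorem 7, Proposition), §7 [BarringtonStraubingTherien1990].
-/

namespace Literature.Computability.MetaComplexity

namespace ProductSpan

open Finset

variable {R : Type*} [CommRing R]

/-! ### Product functions on the cube -/

/-- The **product function** `Q_w(u) = Π_{i : u_i = 1} w_i` on `{0,1}ⁿ` (BST90 §6, p. 124:
`Q_w(u_1,…,u_n) = w_1^{u_1} ⋯ w_n^{u_n}`). [cite: BarringtonStraubingTherien1990, §6 (the functions Q_w, p. 124)] -/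
def prodFn {n : ℕ} (w : Fin n → R) (u : Fin n → Bool) : R := ∏ i, if u i then w i else 1

/-- The `AND` function with values in `R`: `1` at the all-ones input, `0` elsewhere.
[cite: BarringtonStraubingTherien1990, §6 (the AND function, p. 124)] -/
def andFn (R : Type*) [CommRing R] (n : ℕ) (u : Fin n → Bool) : R :=
  if ∀ i, u i = true then 1 else 0

/-- `Q_v · Q_w = Q_{vw}` (componentwise product). [cite: BarringtonStraubingTherien1990, §6 (p. 124)] -/
theorem prodFn_mul {n : ℕ} (v w : Fin n → R) (u : Fin n → Bool) :
    prodFn v u * prodFn w u = prodFn (fun i => v i * w i) u := by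
  unfold prodFn
  rw [← Finset.prod_mul_distrib]
  refine Finset.prod_congr rfl fun i _ => ?_
  split_ifs <;> simp

/-- The constant product function: `Q_{(1,…,1)} = 1`. [cite: BarringtonStraubingTherien1990, §6 (p. 124)] -/
theorem prodFn_one {n : ℕ} (u : Fin n → Bool) : prodFn (fun _ : Fin n => (1 : R)) u = 1 := by
  unfold prodFn
  exact Finset.prod_eq_one fun i _ => by split_ifs <;> rfl

/-- In dimension `0` every product function is `1`. [cite: BarringtonStraubingTherien1990, §6 (p. 124)] -/
theorem prodFn_zero (w : Fin 0 → R) (u : Fin 0 → Bool) : prodFn w u = 1 := by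
  simp [prodFn]

/-- Restricting the first variable to `1`: `Q_w(1,u') = w_0 · Q_{w'}(u')`. [cite: BarringtonStraubingTherien1990, §6 (p. 124)] -/
theorem prodFn_cons_true {n : ℕ} (w : Fin (n + 1) → R) (u' : Fin n → Bool) :
    prodFn w (Fin.cons true u') = w 0 * prodFn (Fin.tail w) u' := by
  unfold prodFn
  rw [Fin.prod_univ_succ]
  simp only [Fin.cons_zero, ↓reduceIte, Fin.cons_succ]
  rfl

/-- Restricting the first variable to `0`: `Q_w(0,u') = Q_{w'}(u')`. [cite: BarringtonStraubingTherien1990, §6 (p. 124)] -/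
theorem prodFn_cons_false {n : ℕ} (w : Fin (n + 1) → R) (u' : Fin n → Bool) :
    prodFn w (Fin.cons false u') = prodFn (Fin.tail w) u' := by
  unfold prodFn
  rw [Fin.prod_univ_succ]
  simp only [Fin.cons_zero, Bool.false_eq_true, ↓reduceIte, Fin.cons_succ, one_mul]
  rfl

/-- `AND_{n+1}(1,u') = AND_n(u')`. [cite: BarringtonStraubingTherien1990, §6 (p. 124)] -/
theorem andFn_cons_true {n : ℕ} (u' : Fin n → Bool) :
    andFn R (n + 1) (Fin.cons true u') = andFn R n u' := by
  unfold andFn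
  congr 1
  simp [Fin.forall_fin_succ]

/-- `AND_{n+1}(0,u') = 0`. [cite: BarringtonStraubingTherien1990, §6 (p. 124)] -/
theorem andFn_cons_false {n : ℕ} (u' : Fin n → Bool) :
    andFn R (n + 1) (Fin.cons false u') = 0 := by
  unfold andFn
  rw [if_neg]
  intro h
  simpa using h 0

/-- `AND_n(1,…,1) = 1`. [cite: BarringtonStraubingTherien1990, §6 (p. 124)] -/
theorem andFn_allTrue (n : ℕ) : andFn R n (fun _ => true) = 1 := by
  simp [andFn]

/-! ### Theorem 7 -/

/-- A representation of `AND` uses at least one product function (`AND ≠ 0` in a nontrivial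
ring). [cite: BarringtonStraubingTherien1990, Theorem 7 (proof)] -/
theorem card_pos_of_and_eq_sum_prodFn [Nontrivial R] {n : ℕ} {W : Finset (Fin n → R)}
    {c : (Fin n → R) → R} (h : ∀ u, andFn R n u = ∑ w ∈ W, c w * prodFn w u) : 0 < W.card := by
  rw [Finset.card_pos]
  by_contra hW
  rw [Finset.not_nonempty_iff_eq_empty] at hW
  have h1 := h (fun _ => true)
  rw [andFn_allTrue, hW, Finset.sum_empty] at h1
  exact one_ne_zero h1

/-- **Barrington–Straubing–Thérien 1990, Theorem 7 (generalised to any nontrivial commutative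
ring and any finite set `S` of admissible entries).** If `AND_n = Σ_{w ∈ W} c_w · Q_w` on
`{0,1}ⁿ` with every `w ∈ W` having all entries in `S`, `|S| ≤ k`, then `kⁿ ≤ |W|·(k − 1)ⁿ`, i.e.
`|W| ≥ (k/(k−1))ⁿ`. (Printed case: `R = F` a finite field, `S = F*`, `k = |F| − 1`.) Proof by
induction on `n` via the most popular first entry (see the module docstring); BST's own proof
goes through the Fourier transform on `(F*)ⁿ`. [cite: BarringtonStraubingTherien1990, Theorem 7] -/
theorem pow_le_card_mul_pow_of_and_eq_sum_prodFn [Nontrivial R] [DecidableEq R] (S : Finset R)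
    {k : ℕ} (hk : S.card ≤ k) :
    ∀ (n : ℕ) (W : Finset (Fin n → R)) (c : (Fin n → R) → R),
      (∀ w ∈ W, ∀ i, w i ∈ S) → (∀ u, andFn R n u = ∑ w ∈ W, c w * prodFn w u) →
        k ^ n ≤ W.card * (k - 1) ^ n := by
  intro n
  induction n with
  | zero =>
    intro W c _ h
    simpa using card_pos_of_and_eq_sum_prodFn h
  | succ n ih =>
    intro W c hWS h
    have hWpos : 0 < W.card := card_pos_of_and_eq_sum_prodFn h
    -- the multiplicities of the first entries
    set mult : R → ℕ := fun a => (W.filter fun w => w 0 = a).card with hmult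
    have hsum : ∑ a ∈ S, mult a = W.card := by
      rw [hmult, ← Finset.card_eq_sum_card_fiberwise fun w hw => hWS w hw 0]
    -- `S` is nonempty (some `w ∈ W`, and `w 0 ∈ S`)
    have hSne : S.Nonempty := by
      obtain ⟨w, hw⟩ := Finset.card_pos.1 hWpos
      exact ⟨w 0, hWS w hw 0⟩
    -- the most popular first entry `λ`
    obtain ⟨lam, hlamS, hlam⟩ := Finset.exists_max_image S mult hSne
    have hpigeon : W.card ≤ k * mult lam := by
      rw [← hsum]
      calc ∑ a ∈ S, mult a ≤ ∑ _a ∈ S, mult lam := Finset.sum_le_sum fun a ha => hlam a ha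
        _ = S.card * mult lam := by rw [Finset.sum_const, smul_eq_mul]
        _ ≤ k * mult lam := Nat.mul_le_mul_right _ hk
    -- the surviving index vectors and their tails
    set Wl : Finset (Fin (n + 1) → R) := W.filter fun w => w 0 ≠ lam with hWl
    set W' : Finset (Fin n → R) := Wl.image Fin.tail with hW'
    have hcardWl : Wl.card + mult lam = W.card := by
      rw [hWl, hmult]
      have hc := Finset.card_filter_add_card_filter_not (s := W) (fun w => w 0 ≠ lam)
      have e : (W.filter fun w => ¬ w 0 ≠ lam) = W.filter fun w => w 0 = lam :=
        Finset.filter_congr fun w _ => not_not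
      rw [e] at hc
      exact hc
    have hW'S : ∀ v ∈ W', ∀ i, v i ∈ S := by
      intro v hv i
      obtain ⟨w, hw, rfl⟩ := Finset.mem_image.1 hv
      exact hWS w (Finset.mem_filter.1 hw).1 i.succ
    -- the new representation of `AND_n`
    set c' : (Fin n → R) → R := fun v =>
      ∑ w ∈ Wl.filter (fun w => Fin.tail w = v), c w * (w 0 - lam) with hc'
    have hrep : ∀ u' : Fin n → Bool, andFn R n u' = ∑ v ∈ W', c' v * prodFn v u' := by
      intro u'
      -- regroup the sum over `W'` as a sum over `Wl`
      have h1 : ∑ v ∈ W', c' v * prodFn v u' =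
          ∑ w ∈ Wl, c w * (w 0 - lam) * prodFn (Fin.tail w) u' := by
        calc ∑ v ∈ W', c' v * prodFn v u'
            = ∑ v ∈ W', ∑ w ∈ Wl.filter (fun w => Fin.tail w = v),
                c w * (w 0 - lam) * prodFn (Fin.tail w) u' := by
              refine Finset.sum_congr rfl fun v _ => ?_
              simp only [hc', Finset.sum_mul]
              refine Finset.sum_congr rfl fun w hw => ?_
              rw [(Finset.mem_filter.1 hw).2]
          _ = ∑ w ∈ Wl, c w * (w 0 - lam) * prodFn (Fin.tail w) u' :=
              Finset.sum_fiberwise_of_maps_to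
                (fun w hw => Finset.mem_image_of_mem Fin.tail hw) _
      -- the terms with first entry `λ` vanish, so the sum over `Wl` is the sum over `W`
      have h2 : ∑ w ∈ Wl, c w * (w 0 - lam) * prodFn (Fin.tail w) u' =
          ∑ w ∈ W, c w * (w 0 - lam) * prodFn (Fin.tail w) u' := by
        rw [hWl, Finset.sum_filter]
        refine Finset.sum_congr rfl fun w _ => ?_
        by_cases hw0 : w 0 = lam
        · rw [if_neg (not_not.2 hw0), hw0, sub_self, mul_zero, zero_mul]
        · rw [if_pos hw0]
      -- and that is `AND_{n+1}(1,u') − λ·AND_{n+1}(0,u') = AND_n(u')`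
      have h3 : ∑ w ∈ W, c w * (w 0 - lam) * prodFn (Fin.tail w) u' =
          andFn R (n + 1) (Fin.cons true u') - lam * andFn R (n + 1) (Fin.cons false u') := by
        rw [h (Fin.cons true u'), h (Fin.cons false u'), Finset.mul_sum, ← Finset.sum_sub_distrib]
        refine Finset.sum_congr rfl fun w _ => ?_
        rw [prodFn_cons_true, prodFn_cons_false]
        ring
      rw [h1, h2, h3, andFn_cons_true, andFn_cons_false, mul_zero, sub_zero]
    -- induction hypothesis for `W'`
    have hIH := ih W' c' hW'S hrep
    have hW'le : W'.card ≤ Wl.card := Finset.card_image_le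
    -- arithmetic: `k·|Wl| ≤ (k−1)·|W|`
    have hkey : k * Wl.card ≤ (k - 1) * W.card := by
      have hk1 : 1 ≤ k := Nat.lt_of_lt_of_le (Finset.card_pos.2 hSne) hk
      have e1 : k * Wl.card + k * mult lam = k * W.card := by
        rw [← mul_add, hcardWl]
      have e2 : (k - 1) * W.card + W.card = k * W.card := by
        rw [Nat.sub_mul, Nat.one_mul, Nat.sub_add_cancel (Nat.le_mul_of_pos_left _ hk1)]
      omega
    calc k ^ (n + 1) = k * k ^ n := by ring
      _ ≤ k * (W'.card * (k - 1) ^ n) := Nat.mul_le_mul_left _ hIH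
      _ ≤ k * (Wl.card * (k - 1) ^ n) :=
          Nat.mul_le_mul_left _ (Nat.mul_le_mul_right _ hW'le)
      _ = k * Wl.card * (k - 1) ^ n := by ring
      _ ≤ (k - 1) * W.card * (k - 1) ^ n := Nat.mul_le_mul_right _ hkey
      _ = W.card * (k - 1) ^ (n + 1) := by ring

/-! ### The span of a fixed set of product functions: closure properties

(BST90 §6–7: "weight is submultiplicative"; used to count the product functions behind a
`MOD`-gate circuit.) -/

section Span

variable {n : ℕ}

/-- `f : {0,1}ⁿ → R` is an `R`-linear combination of the product functions `Q_w`, `w ∈ 𝒲`.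
[cite: BarringtonStraubingTherien1990, §6 (weight of a function, p. 123)] -/
def InSpan (𝒲 : Finset (Fin n → R)) (f : (Fin n → Bool) → R) : Prop :=
  ∃ c : (Fin n → R) → R, ∀ u, f u = ∑ w ∈ 𝒲, c w * prodFn w u

/-- A product function from `𝒲` is in the span. [cite: BarringtonStraubingTherien1990, §6 (p. 123)] -/
theorem inSpan_prodFn [DecidableEq R] {𝒲 : Finset (Fin n → R)} {w : Fin n → R} (hw : w ∈ 𝒲) :
    InSpan 𝒲 (prodFn w) := by
  refine ⟨fun v => if v = w then 1 else 0, fun u => ?_⟩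
  symm
  beta_reduce
  rw [Finset.sum_eq_single w (fun v _ hvw => by rw [if_neg hvw, zero_mul])
    (fun hw' => absurd hw hw'), if_pos rfl, one_mul]

/-- The zero function is in every span. [cite: BarringtonStraubingTherien1990, §6 (p. 123)] -/
theorem inSpan_zero (𝒲 : Finset (Fin n → R)) : InSpan 𝒲 (fun _ => (0 : R)) :=
  ⟨fun _ => 0, fun u => by simp⟩

/-- Spans are closed under addition. [cite: BarringtonStraubingTherien1990, §6 (p. 123)] -/
theorem InSpan.add {𝒲 : Finset (Fin n → R)} {f g : (Fin n → Bool) → R} (hf : InSpan 𝒲 f)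
    (hg : InSpan 𝒲 g) : InSpan 𝒲 (fun u => f u + g u) := by
  obtain ⟨c, hc⟩ := hf
  obtain ⟨d, hd⟩ := hg
  refine ⟨fun w => c w + d w, fun u => ?_⟩
  beta_reduce
  rw [hc u, hd u, ← Finset.sum_add_distrib]
  exact Finset.sum_congr rfl fun w _ => by ring

/-- Spans are closed under scalar multiplication. [cite: BarringtonStraubingTherien1990, §6 (p. 123)] -/
theorem InSpan.smul {𝒲 : Finset (Fin n → R)} {f : (Fin n → Bool) → R} (hf : InSpan 𝒲 f) (a : R) :
    InSpan 𝒲 (fun u => a * f u) := by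
  obtain ⟨c, hc⟩ := hf
  refine ⟨fun w => a * c w, fun u => ?_⟩
  beta_reduce
  rw [hc u, Finset.mul_sum]
  exact Finset.sum_congr rfl fun w _ => by ring

/-- Spans are closed under subtraction. [cite: BarringtonStraubingTherien1990, §6 (p. 123)] -/
theorem InSpan.sub {𝒲 : Finset (Fin n → R)} {f g : (Fin n → Bool) → R} (hf : InSpan 𝒲 f)
    (hg : InSpan 𝒲 g) : InSpan 𝒲 (fun u => f u - g u) := by
  have h := hf.add (hg.smul (-1))
  refine (h.imp fun c hc => fun u => ?_)
  have hcu := hc u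
  beta_reduce at hcu
  beta_reduce
  rw [← hcu]; ring

/-- Spans are closed under finite sums. [cite: BarringtonStraubingTherien1990, §6 (p. 123)] -/
theorem InSpan.sum {𝒲 : Finset (Fin n → R)} {ι : Type*} (T : Finset ι)
    {f : ι → (Fin n → Bool) → R} (hf : ∀ j ∈ T, InSpan 𝒲 (f j)) :
    InSpan 𝒲 (fun u => ∑ j ∈ T, f j u) := by
  classical
  induction T using Finset.induction_on with
  | empty => simpa using inSpan_zero 𝒲
  | insert a T ha ih =>
    have h := (hf a (Finset.mem_insert_self a T)).add
      (ih fun j hj => hf j (Finset.mem_insert_of_mem hj))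
    refine h.imp fun c hc => fun u => ?_
    have hcu := hc u
    beta_reduce at hcu
    beta_reduce
    rw [Finset.sum_insert ha, hcu]

/-- Monotonicity in the index set. [cite: BarringtonStraubingTherien1990, §6 (p. 123)] -/
theorem InSpan.mono [DecidableEq R] {𝒲 𝒲' : Finset (Fin n → R)} {f : (Fin n → Bool) → R}
    (hf : InSpan 𝒲 f) (h : 𝒲 ⊆ 𝒲') : InSpan 𝒲' f := by
  obtain ⟨c, hc⟩ := hf
  refine ⟨fun w => if w ∈ 𝒲 then c w else 0, fun u => ?_⟩
  rw [hc u]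
  simp only [ite_mul, zero_mul]
  rw [← Finset.sum_filter, Finset.filter_mem_eq_inter, Finset.inter_eq_right.2 h]

/-- Re-indexing: a combination `Σ_{t ∈ T} a_t · Q_{w(t)}` indexed by any finite set lies in the
span of the image `w(T)`. [cite: BarringtonStraubingTherien1990, §6 (p. 123)] -/
theorem inSpan_image_of_eq_sum [DecidableEq R] {ι : Type*} (T : Finset ι) (a : ι → R)
    (w : ι → Fin n → R) {f : (Fin n → Bool) → R}
    (hf : ∀ u, f u = ∑ t ∈ T, a t * prodFn (w t) u) : InSpan (T.image w) f := by
  refine ⟨fun v => ∑ t ∈ T.filter (fun t => w t = v), a t, fun u => ?_⟩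
  rw [hf u]
  beta_reduce
  symm
  calc ∑ v ∈ T.image w, (∑ t ∈ T.filter (fun t => w t = v), a t) * prodFn v u
      = ∑ v ∈ T.image w, ∑ t ∈ T.filter (fun t => w t = v), a t * prodFn (w t) u := by
        refine Finset.sum_congr rfl fun v _ => ?_
        rw [Finset.sum_mul]
        refine Finset.sum_congr rfl fun t ht => ?_
        rw [(Finset.mem_filter.1 ht).2]
    _ = ∑ t ∈ T, a t * prodFn (w t) u :=
        Finset.sum_fiberwise_of_maps_to (fun t ht => Finset.mem_image_of_mem w ht) _

/-- The pointwise-product index set `{v·w : v ∈ 𝒱, w ∈ 𝒲}`. [cite: BarringtonStraubingTherien1990, §6 (Q_v · Q_w = Q_{vw}, p. 124)] -/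
def pairMul [DecidableEq R] (𝒱 𝒲 : Finset (Fin n → R)) : Finset (Fin n → R) :=
  (𝒱 ×ˢ 𝒲).image fun vw => fun i => vw.1 i * vw.2 i

/-- `|𝒱·𝒲| ≤ |𝒱|·|𝒲|` ("weight is submultiplicative"). [cite: BarringtonStraubingTherien1990, §7 (weight is submultiplicative, p. 125)] -/
theorem card_pairMul_le [DecidableEq R] (𝒱 𝒲 : Finset (Fin n → R)) :
    (pairMul 𝒱 𝒲).card ≤ 𝒱.card * 𝒲.card :=
  Finset.card_image_le.trans (Finset.card_product _ _).le

/-- Entries of `𝒱·𝒲` lie in `S` if `S` is closed under multiplication. [cite: BarringtonStraubingTherien1990, §6 (p. 124)] -/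
theorem entries_pairMul [DecidableEq R] {S : Finset R} (hS : ∀ a ∈ S, ∀ b ∈ S, a * b ∈ S)
    {𝒱 𝒲 : Finset (Fin n → R)} (hV : ∀ v ∈ 𝒱, ∀ i, v i ∈ S) (hW : ∀ w ∈ 𝒲, ∀ i, w i ∈ S) :
    ∀ z ∈ pairMul 𝒱 𝒲, ∀ i, z i ∈ S := by
  intro z hz i
  obtain ⟨⟨v, w⟩, hvw, rfl⟩ := Finset.mem_image.1 hz
  rw [Finset.mem_product] at hvw
  exact hS _ (hV v hvw.1 i) _ (hW w hvw.2 i)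

/-- **Products**: `span(𝒱) · span(𝒲) ⊆ span(𝒱·𝒲)`. [cite: BarringtonStraubingTherien1990, §7 (weight is submultiplicative, p. 125)] -/
theorem InSpan.mul [DecidableEq R] {𝒱 𝒲 : Finset (Fin n → R)} {f g : (Fin n → Bool) → R}
    (hf : InSpan 𝒱 f) (hg : InSpan 𝒲 g) : InSpan (pairMul 𝒱 𝒲) (fun u => f u * g u) := by
  obtain ⟨c, hc⟩ := hf
  obtain ⟨d, hd⟩ := hg
  refine inSpan_image_of_eq_sum (𝒱 ×ˢ 𝒲) (fun vw => c vw.1 * d vw.2)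
    (fun vw => fun i => vw.1 i * vw.2 i) fun u => ?_
  rw [hc u, hd u, Finset.sum_mul_sum, Finset.sum_product]
  refine Finset.sum_congr rfl fun v _ => Finset.sum_congr rfl fun w _ => ?_
  rw [← prodFn_mul]
  ring

/-- The `e`-fold product sets `𝒲^{(e)}`: `𝒲^{(0)} = {𝟙}`, `𝒲^{(e+1)} = 𝒲^{(e)}·𝒲`.
[cite: BarringtonStraubingTherien1990, §7 (p. 125)] -/
def powSet [DecidableEq R] (𝒲 : Finset (Fin n → R)) : ℕ → Finset (Fin n → R)
  | 0 => {fun _ => 1}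
  | e + 1 => pairMul (powSet 𝒲 e) 𝒲

/-- `|𝒲^{(e)}| ≤ |𝒲|^e`. [cite: BarringtonStraubingTherien1990, §7 (p. 125)] -/
theorem card_powSet_le [DecidableEq R] (𝒲 : Finset (Fin n → R)) :
    ∀ e, (powSet 𝒲 e).card ≤ 𝒲.card ^ e
  | 0 => by simp [powSet]
  | e + 1 => by
    rw [powSet, pow_succ]
    exact (card_pairMul_le _ _).trans (Nat.mul_le_mul_right _ (card_powSet_le 𝒲 e))

/-- Entries of `𝒲^{(e)}` lie in `S` (`S` multiplicatively closed, `1 ∈ S`). [cite: BarringtonStraubingTherien1990, §7 (p. 125)] -/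
theorem entries_powSet [DecidableEq R] {S : Finset R} (hS : ∀ a ∈ S, ∀ b ∈ S, a * b ∈ S)
    (h1 : (1 : R) ∈ S)
    {𝒲 : Finset (Fin n → R)} (hW : ∀ w ∈ 𝒲, ∀ i, w i ∈ S) :
    ∀ e, ∀ z ∈ powSet 𝒲 e, ∀ i, z i ∈ S
  | 0 => by
    intro z hz i
    rw [powSet, Finset.mem_singleton] at hz
    rw [hz]; exact h1
  | e + 1 => entries_pairMul hS (entries_powSet hS h1 hW e) hW

/-- `𝟙 ∈ 𝒲^{(e)}` whenever `𝟙 ∈ 𝒲`. [cite: BarringtonStraubingTherien1990, §7 (p. 125)] -/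
theorem one_mem_powSet [DecidableEq R] {𝒲 : Finset (Fin n → R)} (h1 : (fun _ => (1 : R)) ∈ 𝒲) :
    ∀ e, (fun _ => (1 : R)) ∈ powSet 𝒲 e
  | 0 => by simp [powSet]
  | e + 1 => by
    rw [powSet, pairMul, Finset.mem_image]
    exact ⟨⟨fun _ => 1, fun _ => 1⟩, Finset.mem_product.2 ⟨one_mem_powSet h1 e, h1⟩,
      funext fun _ => mul_one _⟩

/-- **Powers**: `span(𝒲)^e ⊆ span(𝒲^{(e)})`. [cite: BarringtonStraubingTherien1990, §7 (p. 125)] -/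
theorem InSpan.pow [DecidableEq R] {𝒲 : Finset (Fin n → R)} {f : (Fin n → Bool) → R}
    (hf : InSpan 𝒲 f) : ∀ e, InSpan (powSet 𝒲 e) (fun u => f u ^ e)
  | 0 => by
    refine ⟨fun _ => 1, fun u => ?_⟩
    simp [powSet, prodFn_one]
  | e + 1 => by
    have h := (InSpan.pow hf e).mul hf
    refine h.imp fun c hc => fun u => ?_
    have hcu := hc u
    beta_reduce at hcu
    beta_reduce
    rw [pow_succ, hcu, powSet]

/-- **Theorem 7 for spans**: if `AND_n ∈ span{Q_w : w ∈ 𝒲}` with all entries of `𝒲` in `S`,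
`|S| ≤ k`, then `kⁿ ≤ |𝒲|·(k−1)ⁿ`. [cite: BarringtonStraubingTherien1990, Theorem 7] -/
theorem InSpan.pow_le_card_mul_pow [Nontrivial R] [DecidableEq R] {S : Finset R} {k : ℕ}
    (hk : S.card ≤ k)
    {𝒲 : Finset (Fin n → R)} (hW : ∀ w ∈ 𝒲, ∀ i, w i ∈ S) (h : InSpan 𝒲 (andFn R n)) :
    k ^ n ≤ 𝒲.card * (k - 1) ^ n := by
  obtain ⟨c, hc⟩ := h
  exact pow_le_card_mul_pow_of_and_eq_sum_prodFn S hk n 𝒲 c hW hc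

end Span

/-! ### Mod-periodic symmetric targets (the `MOD_r` form of Theorem 7; BST90 §8 / Krause–Pudlák-type)

The same restriction induction bounds representations of any NON-CONSTANT `r`-periodic symmetric
function `u ↦ γ(|u| mod r)` (e.g. a `MOD_r` residue test), provided the admissible entries `S`
contain no `r`-th root of unity other than `1` and `r ≠ 0` in the field: restricting the first
variable and subtracting `λ×` turns `γ` into `γ'(j) = γ(j+1) − λ·γ(j)`, which is again non-constant
(`exists_ne_shiftSub`), so after `n − (r−1)` steps a non-zero function on `{0,1}^{r−1}` remains.
This is the product-function core of the printed bounds for `MOD_q ∘ MOD_m` circuits computing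
`MOD_r` (Barrington–Straubing–Thérien 1990 §8; Krause–Pudlák 1997; Grolmusz–Tardos 2000), in
the generality: any field `F` with `(r : F) ≠ 0`, any finite `S ⊆ F` with `a ∈ S ⇒ a^r ≠ 1 ∨ a = 1`.
-/

section ModPeriodic

variable {F : Type*} [Field F]

/-- The weight of `Fin.cons true u'` is the weight of `u'` plus one. [folklore] -/
private theorem card_filter_cons_true {n : ℕ} (u' : Fin n → Bool) :
    (univ.filter fun i => (Fin.cons true u' : Fin (n + 1) → Bool) i = true).card =
      (univ.filter fun i => u' i = true).card + 1 := by
  rw [Finset.card_filter, Finset.card_filter, Fin.sum_univ_succ, Fin.cons_zero, if_pos rfl,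
    add_comm]
  simp only [Fin.cons_succ]

/-- The weight of `Fin.cons false u'` is the weight of `u'`. [folklore] -/
private theorem card_filter_cons_false {n : ℕ} (u' : Fin n → Bool) :
    (univ.filter fun i => (Fin.cons false u' : Fin (n + 1) → Bool) i = true).card =
      (univ.filter fun i => u' i = true).card := by
  rw [Finset.card_filter, Finset.card_filter, Fin.sum_univ_succ, Fin.cons_zero,
    if_neg Bool.false_ne_true, zero_add]
  exact Finset.sum_congr rfl fun i _ => by rw [Fin.cons_succ]

/-- Every weight `j ≤ n` is attained on `{0,1}ⁿ`. [folklore] -/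
private theorem exists_card_filter_eq {n : ℕ} : ∀ {j : ℕ}, j ≤ n →
    ∃ u : Fin n → Bool, (univ.filter fun i => u i = true).card = j := by
  induction n with
  | zero =>
    intro j hj
    refine ⟨fun _ => false, ?_⟩
    rw [Nat.le_zero.1 hj, Finset.card_eq_zero, Finset.filter_eq_empty_iff]
    intro i _
    exact Bool.false_ne_true
  | succ n ih =>
    intro j hj
    rcases Nat.eq_zero_or_pos j with rfl | hpos
    · refine ⟨fun _ => false, ?_⟩
      rw [Finset.card_eq_zero, Finset.filter_eq_empty_iff]
      intro i _
      exact Bool.false_ne_true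
    · obtain ⟨u', hu'⟩ := ih (j := j - 1) (by omega)
      refine ⟨Fin.cons true u', ?_⟩
      rw [card_filter_cons_true, hu']
      omega

/-- **Non-constancy survives the twisted difference.** For `γ : ℤ/r → F` non-constant and
`λ ∈ F` with `λ^r ≠ 1`, or `λ = 1` and `r ≠ 0` in `F`, the function `j ↦ γ(j+1) − λ·γ(j)` is again
non-constant. (If it were constant `= κ`: for `λ = 1`, `γ(j + r) = γ(j) + rκ` forces `κ = 0` and `γ`
constant; for `λ ≠ 1`, `δ(j) = γ(j) − κ/(1−λ)` satisfies `δ(j+1) = λδ(j)`, so `δ = λ^r δ = 0`.)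
[cite: BarringtonStraubingTherien1990, §8 (extensions of p-groups by abelian groups; the MOD case)] -/
theorem exists_ne_shiftSub {r : ℕ} [NeZero r] (γ : ZMod r → F) (hγ : ∃ a b, γ a ≠ γ b) (lam : F)
    (hlam : lam ^ r ≠ 1 ∨ (lam = 1 ∧ (r : F) ≠ 0)) :
    ∃ a b, γ (a + 1) - lam * γ a ≠ γ (b + 1) - lam * γ b := by
  by_contra hcon
  push Not at hcon
  set κ := γ (0 + 1) - lam * γ 0 with hκ
  have hstep : ∀ a, γ (a + 1) = lam * γ a + κ := by
    intro a
    have := hcon a 0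
    rw [← hκ] at this
    rw [← this]; ring
  obtain ⟨a₀, b₀, hab⟩ := hγ
  rcases hlam with hlr | ⟨hl1, hrF⟩
  · -- `λ^r ≠ 1`, hence `λ ≠ 1`
    have hl1 : lam ≠ 1 := by
      rintro rfl
      exact hlr (one_pow r)
    have h1l : (1 - lam) ≠ 0 := sub_ne_zero.2 (Ne.symm hl1)
    set μ := κ * (1 - lam)⁻¹ with hμ
    have hδ : ∀ a, γ (a + 1) - μ = lam * (γ a - μ) := by
      intro a
      rw [hstep a, hμ]
      field_simp
      ring
    have hiter : ∀ (t : ℕ) (a : ZMod r), γ (a + t) - μ = lam ^ t * (γ a - μ) := by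
      intro t
      induction t with
      | zero => intro a; simp
      | succ t ih =>
        intro a
        rw [Nat.cast_succ, ← add_assoc, hδ, ih, pow_succ]
        ring
    have hconst : ∀ a, γ a = μ := by
      intro a
      have h := hiter r a
      rw [ZMod.natCast_self, add_zero] at h
      have h' : (1 - lam ^ r) * (γ a - μ) = 0 := by rw [sub_mul, one_mul, ← h]; ring
      rcases mul_eq_zero.1 h' with h1 | h2
      · exact absurd (sub_eq_zero.1 h1).symm hlr
      · exact sub_eq_zero.1 h2
    exact hab (by rw [hconst a₀, hconst b₀])
  · -- `λ = 1`
    subst hl1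
    have hiter : ∀ (t : ℕ) (a : ZMod r), γ (a + t) = γ a + t * κ := by
      intro t
      induction t with
      | zero => intro a; simp
      | succ t ih =>
        intro a
        rw [Nat.cast_succ, ← add_assoc, hstep, ih, one_mul]
        push_cast
        ring
    have hκ0 : κ = 0 := by
      have h := hiter r 0
      rw [ZMod.natCast_self, add_zero] at h
      have h' : (r : F) * κ = 0 := by
        have := sub_eq_zero.2 h.symm
        rw [← this]; ring
      rcases mul_eq_zero.1 h' with h1 | h2
      · exact absurd h1 hrF
      · exact h2
    have hconst : ∀ a : ZMod r, γ a = γ 0 := by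
      intro a
      have h := hiter a.val 0
      rw [zero_add, ZMod.natCast_zmod_val, hκ0, mul_zero, add_zero] at h
      exact h
    exact hab (by rw [hconst a₀, hconst b₀])

/-- **Theorem 7 for `MOD_r`-type targets.** Let `F` be a field with `(r : F) ≠ 0`, `S ⊆ F` finite
with `|S| ≤ k` and `a^r ≠ 1` for every `a ∈ S ∖ {1}`, and `γ : ℤ/r → F` non-constant. If
`γ(|u| mod r) = Σ_{w ∈ W} c_w Q_w(u)` on `{0,1}ⁿ` with `W ⊆ Sⁿ` and `n ≥ r − 1`, then
`k^{n−(r−1)} ≤ |W|·(k−1)^{n−(r−1)}`, i.e. `|W| ≥ (k/(k−1))^{n−r+1}`. Proof: the restriction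
induction of Theorem 7 with `exists_ne_shiftSub`; the base `n = r − 1` holds because all `r`
residues occur as weights, so the function is not identically zero.
[cite: BarringtonStraubingTherien1990, Theorem 7 and §8] -/
theorem pow_le_card_mul_pow_of_modPeriodic_eq_sum_prodFn [DecidableEq F] {r : ℕ} [NeZero r]
    (hrF : (r : F) ≠ 0) (S : Finset F) {k : ℕ} (hk : S.card ≤ k)
    (hS : ∀ a ∈ S, a ^ r ≠ 1 ∨ a = 1) :
    ∀ (n : ℕ) (W : Finset (Fin n → F)) (c : (Fin n → F) → F) (γ : ZMod r → F),
      (∃ a b, γ a ≠ γ b) → (∀ w ∈ W, ∀ i, w i ∈ S) →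
      (∀ u, γ ((univ.filter fun i => u i = true).card : ℕ) = ∑ w ∈ W, c w * prodFn w u) →
      r - 1 ≤ n → k ^ (n - (r - 1)) ≤ W.card * (k - 1) ^ (n - (r - 1)) := by
  -- non-vanishing: with all residues available as weights, a non-constant `γ` gives `W ≠ ∅`
  have hne : ∀ (n : ℕ) (W : Finset (Fin n → F)) (c : (Fin n → F) → F) (γ : ZMod r → F),
      (∃ a b, γ a ≠ γ b) →
      (∀ u, γ ((univ.filter fun i => u i = true).card : ℕ) = ∑ w ∈ W, c w * prodFn w u) →
      r - 1 ≤ n → 0 < W.card := by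
    intro n W c γ hγ h hn
    rw [Finset.card_pos]
    by_contra hW
    rw [Finset.not_nonempty_iff_eq_empty] at hW
    obtain ⟨a, b, hab⟩ := hγ
    have hval : ∀ x : ZMod r, γ x = 0 := by
      intro x
      obtain ⟨u, hu⟩ := exists_card_filter_eq (n := n) (j := x.val)
        ((Nat.le_sub_one_of_lt (ZMod.val_lt x)).trans hn)
      have := h u
      rw [hu, ZMod.natCast_zmod_val, hW, Finset.sum_empty] at this
      exact this
    exact hab (by rw [hval a, hval b])
  intro n
  induction n with
  | zero =>
    intro W c γ hγ hWS h hn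
    simpa using hne 0 W c γ hγ h hn
  | succ n ih =>
    intro W c γ hγ hWS h hn
    have hWpos : 0 < W.card := hne (n + 1) W c γ hγ h hn
    by_cases hn' : r - 1 ≤ n
    swap
    · -- base of the induction: `n + 1 = r - 1`, exponent `0`
      have e : n + 1 - (r - 1) = 0 := by omega
      rw [e, pow_zero, pow_zero, mul_one]
      exact hWpos
    -- the multiplicities of the first entries
    set mult : F → ℕ := fun a => (W.filter fun w => w 0 = a).card with hmult
    have hsum : ∑ a ∈ S, mult a = W.card := by
      rw [hmult, ← Finset.card_eq_sum_card_fiberwise fun w hw => hWS w hw 0]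
    have hSne : S.Nonempty := by
      obtain ⟨w, hw⟩ := Finset.card_pos.1 hWpos
      exact ⟨w 0, hWS w hw 0⟩
    obtain ⟨lam, hlamS, hlam⟩ := Finset.exists_max_image S mult hSne
    have hpigeon : W.card ≤ k * mult lam := by
      rw [← hsum]
      calc ∑ a ∈ S, mult a ≤ ∑ _a ∈ S, mult lam := Finset.sum_le_sum fun a ha => hlam a ha
        _ = S.card * mult lam := by rw [Finset.sum_const, smul_eq_mul]
        _ ≤ k * mult lam := Nat.mul_le_mul_right _ hk
    set Wl : Finset (Fin (n + 1) → F) := W.filter fun w => w 0 ≠ lam with hWl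
    set W' : Finset (Fin n → F) := Wl.image Fin.tail with hW'
    have hcardWl : Wl.card + mult lam = W.card := by
      rw [hWl, hmult]
      have hc := Finset.card_filter_add_card_filter_not (s := W) (fun w => w 0 ≠ lam)
      have e : (W.filter fun w => ¬ w 0 ≠ lam) = W.filter fun w => w 0 = lam :=
        Finset.filter_congr fun w _ => not_not
      rw [e] at hc
      exact hc
    have hW'S : ∀ v ∈ W', ∀ i, v i ∈ S := by
      intro v hv i
      obtain ⟨w, hw, rfl⟩ := Finset.mem_image.1 hv
      exact hWS w (Finset.mem_filter.1 hw).1 i.succ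
    -- the twisted difference `γ'` and its representation
    set γ' : ZMod r → F := fun j => γ (j + 1) - lam * γ j with hγ'
    have hγ'nc : ∃ a b, γ' a ≠ γ' b :=
      exists_ne_shiftSub γ hγ lam ((hS lam hlamS).imp id fun h1 => ⟨h1, hrF⟩)
    set c' : (Fin n → F) → F := fun v =>
      ∑ w ∈ Wl.filter (fun w => Fin.tail w = v), c w * (w 0 - lam) with hc'
    have hrep : ∀ u' : Fin n → Bool,
        γ' ((univ.filter fun i => u' i = true).card : ℕ) = ∑ v ∈ W', c' v * prodFn v u' := by
      intro u'
      have h1 : ∑ v ∈ W', c' v * prodFn v u' =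
          ∑ w ∈ Wl, c w * (w 0 - lam) * prodFn (Fin.tail w) u' := by
        calc ∑ v ∈ W', c' v * prodFn v u'
            = ∑ v ∈ W', ∑ w ∈ Wl.filter (fun w => Fin.tail w = v),
                c w * (w 0 - lam) * prodFn (Fin.tail w) u' := by
              refine Finset.sum_congr rfl fun v _ => ?_
              simp only [hc', Finset.sum_mul]
              refine Finset.sum_congr rfl fun w hw => ?_
              rw [(Finset.mem_filter.1 hw).2]
          _ = ∑ w ∈ Wl, c w * (w 0 - lam) * prodFn (Fin.tail w) u' :=
              Finset.sum_fiberwise_of_maps_to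
                (fun w hw => Finset.mem_image_of_mem Fin.tail hw) _
      have h2 : ∑ w ∈ Wl, c w * (w 0 - lam) * prodFn (Fin.tail w) u' =
          ∑ w ∈ W, c w * (w 0 - lam) * prodFn (Fin.tail w) u' := by
        rw [hWl, Finset.sum_filter]
        refine Finset.sum_congr rfl fun w _ => ?_
        by_cases hw0 : w 0 = lam
        · rw [if_neg (not_not.2 hw0), hw0, sub_self, mul_zero, zero_mul]
        · rw [if_pos hw0]
      have h3 : ∑ w ∈ W, c w * (w 0 - lam) * prodFn (Fin.tail w) u' =
          γ ((univ.filter fun i => (Fin.cons true u' : Fin (n + 1) → Bool) i = true).card : ℕ) -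
            lam * γ ((univ.filter fun i =>
              (Fin.cons false u' : Fin (n + 1) → Bool) i = true).card : ℕ) := by
        rw [h (Fin.cons true u'), h (Fin.cons false u'), Finset.mul_sum, ← Finset.sum_sub_distrib]
        refine Finset.sum_congr rfl fun w _ => ?_
        rw [prodFn_cons_true, prodFn_cons_false]
        ring
      rw [h1, h2, h3, card_filter_cons_true, card_filter_cons_false, Nat.cast_succ]
    have hIH := ih W' c' γ' hγ'nc hW'S hrep hn'
    have hW'le : W'.card ≤ Wl.card := Finset.card_image_le
    have hkey : k * Wl.card ≤ (k - 1) * W.card := by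
      have hk1 : 1 ≤ k := Nat.lt_of_lt_of_le (Finset.card_pos.2 hSne) hk
      have e1 : k * Wl.card + k * mult lam = k * W.card := by
        rw [← mul_add, hcardWl]
      have e2 : (k - 1) * W.card + W.card = k * W.card := by
        rw [Nat.sub_mul, Nat.one_mul, Nat.sub_add_cancel (Nat.le_mul_of_pos_left _ hk1)]
      omega
    have e : n + 1 - (r - 1) = (n - (r - 1)) + 1 := by omega
    rw [e]
    calc k ^ (n - (r - 1) + 1) = k * k ^ (n - (r - 1)) := by ring
      _ ≤ k * (W'.card * (k - 1) ^ (n - (r - 1))) := Nat.mul_le_mul_left _ hIH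
      _ ≤ k * (Wl.card * (k - 1) ^ (n - (r - 1))) :=
          Nat.mul_le_mul_left _ (Nat.mul_le_mul_right _ hW'le)
      _ = k * Wl.card * (k - 1) ^ (n - (r - 1)) := by ring
      _ ≤ (k - 1) * W.card * (k - 1) ^ (n - (r - 1)) := Nat.mul_le_mul_right _ hkey
      _ = W.card * (k - 1) ^ (n - (r - 1) + 1) := by ring

/-- **Theorem 7 for `MOD_r`-type targets, span form**: if `u ↦ γ(|u| mod r)` (`γ` non-constant)
lies in `span{Q_w : w ∈ 𝒲}` with all entries of `𝒲` in `S` (`|S| ≤ k`, no `r`-th root of unity in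
`S` other than `1`, `(r : F) ≠ 0`) and `n ≥ r − 1`, then `k^{n−(r−1)} ≤ |𝒲|·(k−1)^{n−(r−1)}`.
[cite: BarringtonStraubingTherien1990, Theorem 7 and §8] -/
theorem InSpan.pow_le_card_mul_pow_modPeriodic [DecidableEq F] {r : ℕ} [NeZero r]
    (hrF : (r : F) ≠ 0) {S : Finset F} {k : ℕ} (hk : S.card ≤ k)
    (hS : ∀ a ∈ S, a ^ r ≠ 1 ∨ a = 1) {n : ℕ} {𝒲 : Finset (Fin n → F)}
    (hW : ∀ w ∈ 𝒲, ∀ i, w i ∈ S) {γ : ZMod r → F} (hγ : ∃ a b, γ a ≠ γ b)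
    (h : InSpan 𝒲 (fun u => γ ((univ.filter fun i => u i = true).card : ℕ))) (hn : r - 1 ≤ n) :
    k ^ (n - (r - 1)) ≤ 𝒲.card * (k - 1) ^ (n - (r - 1)) := by
  obtain ⟨c, hc⟩ := h
  exact pow_le_card_mul_pow_of_modPeriodic_eq_sum_prodFn hrF S hk hS n 𝒲 c γ hγ hW hc hn

end ModPeriodic

end ProductSpan

end Literature.Computability.MetaComplexity
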